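import Literature.MathematicalPhysics.QuantumLattice.LiebRobinsonFnwGapRingProofs
import Literature.MathematicalPhysics.QuantumLattice.LiebRobinsonFnwGapTilingProofs
import Literature.MathematicalPhysics.QuantumLattice.LiebRobinsonFnwGapConvergenceProofs
import Literature.MathematicalPhysics.QuantumLattice.LiebRobinsonFnwGapSpectralProofs
import Literature.MathematicalPhysics.QuantumLattice.MatrixProductStatesGaugeProofs
import HarnessLib

/-!
# The uniform spectral gap of the parent Hamiltonian of a normal MPS (FNW Thm. 6.4)

Sibling proof file of `Literature/MathematicalPhysics/QuantumLattice/LiebRobinson.lean`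
(theorem-only: no definition, no named fact): the **discharge**
`fannes_nachtergaele_werner_gap_holds` of the named fact `fannes_nachtergaele_werner_gap`
(**hubbard.S16**; Fannes–Nachtergaele–Werner 1992, Thm. 6.4, in the periodic-ring uniform form of
Perez-Garcia–Verstraete–Wolf–Cirac 2007 §4.2): for a normal MPS tensor `A` there is `ℓ₀` such that
for every `ℓ ≥ ℓ₀` the parent Hamiltonians `parentHamiltonian L ℓ A` have a spectral gap `γ > 0`
uniformly in the ring size `L ≥ 2ℓ`.

Proof as printed (FNW §6, proof of Thm. 6.4, p. 479), adapted to rings. Gauge-normalise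
(`exists_normalised_gauge`: `𝔼(𝟙) = 𝟙`, `𝔼_*(ρ) = ρ`, `ρ ≥ λ𝟙 > 0`, `tr ρ = 1`; the parent
Hamiltonian is gauge invariant, `parentHamiltonian_gauge`). By primitivity the iterates
`𝔼ⁿ(e_a e_dᵀ) → ρ_{da} 𝟙` (`transferOp_pow_single_sub_entry_le`, Doeblin minorisation); fix `p ≥ ℓ`
beyond which they are `δ`-close, `δ` so small (`exists_delta_small`) that FNW's Lemma 6.2 bound is
`≤ 1/4`. Tile a ring `ℤ/L`, `L ≥ 3p`, into `N ≥ 3` segments of lengths in `[p, 2p)`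
(`exists_ring_tiling`) and let `E_k` be the parent projection `h_{n_k} = 𝟙 - G_{n_k}` of the union
`C_k` of segments `k, k+1`, `K = Σ_k E_k`. Then: `K² ≥ (1/3) K` (`fnw_ring_sq_sub_smul_posSemidef`:
non-neighbours commute, neighbours by Lemmas 6.2 + 6.3, `posSemidef_pair_ring` with `ε = 1/4`,
`ε' = 1/3`); `K ≤ 2 c₀ H` (local gaps `h_n ≤ c₀ H^{open}_n` of the finitely many chain lengths
`n ∈ [2p, 3p)`, `exists_pos_smul_parentHamiltonianOpen_sub_parentLocalTerm`, each `h_x` lying in two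
`C_k`); `ker K ⊆ ker H` (`h_x ≤ E_k` for the `C_k` containing the block at `x`); and `H` has the
unique ground state `ringMPS L A` (FNW Thm. 5.7 / PVWC Thm. 10, `exists_eq_smul_ringMPS`). Hence
`gap(H) ≥ 1/(6 c₀)` for all `L ≥ 3p` (`hasSpectralGap_of_dominated_sq_sub_smul`, FNW (6.6)–(6.8)).
The finitely many rings `2ℓ ≤ L < 3p` have unique ground states
(`fannes_nachtergaele_werner_unique_holds`), hence positive gaps; the minimum is the uniform gap.

* `hasSpectralGap_parentHamiltonian_of_tiling` — the estimate for `L ≥ 3p` in the normalised gauge;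
* `exists_uniform_gap_parentHamiltonian_normalised`, `exists_uniform_gap_parentHamiltonian` —
  `∃ L₀ γ > 0, ∀ L ≥ L₀, gap ≥ γ`;
* `fannes_nachtergaele_werner_gap_holds` — the discharge.

## Source

* M. Fannes, B. Nachtergaele, R. F. Werner, *Finitely correlated states on quantum spin chains*,
  Comm. Math. Phys. **144** (1992) 443–490, §6: Lemma 6.1 (p. 475), Lemma 6.2 (p. 476),
  Lemma 6.3 (p. 478), Thm. 6.4 and its proof (p. 479, inequalities (6.6)–(6.8)).
  [FannesNachtergaeleWernerCMP1992]
* D. Perez-Garcia, F. Verstraete, M. M. Wolf, J. I. Cirac, *Matrix product state representations*,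
  Quantum Inf. Comput. **7** (2007) 401, §4.2 (ring form). [PerezGarciaVerstraeteWolfCiracQIC2007]
-/

noncomputable section

open Matrix
open scoped ComplexOrder MatrixOrder

namespace Literature.MathematicalPhysics.QuantumLattice

section QLattice

variable {q D : ℕ}

/-! ### Small helpers -/

/-- If `0 ≤ h ≤ E` and `E φ = 0` then `h φ = 0`. [folklore] -/
theorem mulVec_eq_zero_of_posSemidef_sub {n : Type*} [Fintype n] {E h : Matrix n n ℂ}
    (hh : h.PosSemidef) (hsub : (E - h).PosSemidef) {φ : n → ℂ} (hE : E *ᵥ φ = 0) :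
    h *ᵥ φ = 0 := by
  have h1 : 0 ≤ star φ ⬝ᵥ (E - h) *ᵥ φ := hsub.dotProduct_mulVec_nonneg φ
  rw [sub_mulVec, hE, zero_sub, dotProduct_neg] at h1
  have h2 : 0 ≤ star φ ⬝ᵥ h *ᵥ φ := hh.dotProduct_mulVec_nonneg φ
  exact (hh.dotProduct_mulVec_zero_iff φ).1 (le_antisymm (neg_nonneg.1 h1) h2)

/-- A property of a positive constant which is upward closed and holds, for each member of a
finite set, for some constant, holds for one constant uniformly. [folklore] -/
theorem exists_forall_mem_finset_of_mono {s : Finset ℕ} {P : ℕ → ℝ → Prop}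
    (hmono : ∀ n c c', c ≤ c' → P n c → P n c') (h : ∀ n ∈ s, ∃ c, 0 < c ∧ P n c) :
    ∃ C, 0 < C ∧ ∀ n ∈ s, P n C := by
  classical
  induction s using Finset.induction_on with
  | empty => exact ⟨1, one_pos, by simp⟩
  | insert a s ha ih =>
    obtain ⟨C, hC, hs⟩ := ih fun n hn => h n (Finset.mem_insert_of_mem hn)
    obtain ⟨c, hc, hPa⟩ := h a (Finset.mem_insert_self a s)
    refine ⟨max c C, lt_max_of_lt_left hc, fun n hn => ?_⟩
    rcases Finset.mem_insert.1 hn with rfl | hn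
    · exact hmono _ _ _ (le_max_left _ _) hPa
    · exact hmono _ _ _ (le_max_right _ _) (hs n hn)

/-- A property of a positive constant which is downward closed (among positive constants) and
holds, for each member of a finite set, for some positive constant, holds for one positive constant
uniformly. [folklore] -/
theorem exists_forall_mem_finset_of_anti {s : Finset ℕ} {P : ℕ → ℝ → Prop}
    (hanti : ∀ n c c', 0 < c' → c' ≤ c → P n c → P n c') (h : ∀ n ∈ s, ∃ c, 0 < c ∧ P n c) :
    ∃ C, 0 < C ∧ ∀ n ∈ s, P n C := by
  classical
  induction s using Finset.induction_on with
  | empty => exact ⟨1, one_pos, by simp⟩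
  | insert a s ha ih =>
    obtain ⟨C, hC, hs⟩ := ih fun n hn => h n (Finset.mem_insert_of_mem hn)
    obtain ⟨c, hc, hPa⟩ := h a (Finset.mem_insert_self a s)
    refine ⟨min c C, lt_min hc hC, fun n hn => ?_⟩
    rcases Finset.mem_insert.1 hn with rfl | hn
    · exact hanti _ _ _ (lt_min hc hC) (min_le_left _ _) hPa
    · exact hanti _ _ _ (lt_min hc hC) (min_le_right _ _) (hs n hn)

/-- **Choice of the closeness parameter.** For `λ > 0` and `D ≥ 1` there is `δ > 0` with
`δ D² ≤ λ/2` and `(2/λ)(δ D² λ^{-1/2} + δ² D⁴ λ^{-5/2}) ≤ 1/4` (the bound of FNW Lemma 6.2 made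
`≤ 1/4`, so that Lemma 6.3 applies with `ε' = 1/3`). [folklore] -/
theorem exists_delta_small {lam : ℝ} (hlam : 0 < lam) {Dr : ℝ} (hD : 1 ≤ Dr) :
    ∃ δ : ℝ, 0 < δ ∧ δ * Dr ^ 2 ≤ lam / 2 ∧
      2 / lam * (δ * Dr ^ 2 * Real.sqrt lam⁻¹ +
        (δ * Dr ^ 2) ^ 2 * lam⁻¹ ^ 2 * Real.sqrt lam⁻¹) ≤ 1 / 4 := by
  set s : ℝ := Real.sqrt lam⁻¹ with hs
  have hs0 : 0 < s := Real.sqrt_pos.2 (inv_pos.2 hlam)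
  set B : ℝ := 8 * s * (1 + lam⁻¹ ^ 2) with hB
  have hB0 : 0 < B := by positivity
  set u₀ : ℝ := min 1 (min (lam / 2) (lam / B)) with hu₀
  have hu0 : 0 < u₀ := lt_min one_pos (lt_min (by linarith) (div_pos hlam hB0))
  have hu1 : u₀ ≤ 1 := min_le_left _ _
  have hu2 : u₀ ≤ lam / 2 := (min_le_right _ _).trans (min_le_left _ _)
  have hu3 : u₀ ≤ lam / B := (min_le_right _ _).trans (min_le_right _ _)
  have hD2 : 0 < Dr ^ 2 := by positivity
  refine ⟨u₀ / Dr ^ 2, div_pos hu0 hD2, ?_, ?_⟩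
  · rw [div_mul_cancel₀ _ hD2.ne']
    exact hu2
  · rw [div_mul_cancel₀ _ hD2.ne']
    have hsq : u₀ ^ 2 ≤ u₀ := by nlinarith
    have h2l : 0 ≤ 2 / lam := by positivity
    calc 2 / lam * (u₀ * s + u₀ ^ 2 * lam⁻¹ ^ 2 * s)
        ≤ 2 / lam * (u₀ * s + u₀ * lam⁻¹ ^ 2 * s) := by gcongr
      _ = 2 / lam * (u₀ * (B / 8)) := by rw [hB]; ring
      _ ≤ 2 / lam * (lam / B * (B / 8)) := by gcongr
      _ = 1 / 4 := by field_simp; ring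

/-! ### The local gap transported to a ring block -/

/-- **The local gap on a ring block.** If `h_{N'} ≤ c₀ H^{open}_{N', ℓ}` on the open chain of
`N'` sites, then on the ring (`N' ≤ L`) the big-block projection `(h_{N'})_{x,…}` is dominated by
`c₀ Σ_{j + ℓ ≤ N'} h_{x+j,…,x+j+ℓ-1}`. [cite: FannesNachtergaeleWernerCMP1992, Lemma 6.1 / (6.5)] -/
theorem posSemidef_smul_sum_sub_bigBlock (L : ℕ) [NeZero L] {N' ℓ : ℕ} (hN' : N' ≤ L) (x : ZMod L)
    (A : MPSTensor q D) {c₀ : ℝ}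
    (hgap : ((c₀ : ℂ) • parentHamiltonianOpen N' ℓ A - parentLocalTerm N' A).PosSemidef) :
    ((c₀ : ℂ) • (∑ j : Fin N', if (j : ℕ) + ℓ ≤ N' then
        localOp (ringBlock L ℓ (x + ((j : ℕ) : ZMod L)))
          (onRingBlock L ℓ (x + ((j : ℕ) : ZMod L)) (parentLocalTerm ℓ A)) else 0) -
      localOp (ringBlock L N' x) (onRingBlock L N' x (parentLocalTerm N' A))).PosSemidef := by
  have h := posSemidef_localOp (ringBlock L N' x) (posSemidef_onRingBlock L N' x hgap)
  rw [onRingBlock, localOp_submatrix_sub, localOp_submatrix_smul] at h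
  rw [← localOp_ringBlock_onRingBlock_parentHamiltonianOpen L hN' x ℓ A]
  exact h

/-! ### The uniform gap from a tiling -/

/-- **FNW's Theorem 6.4 on a ring, given a tiling.** In the normalised gauge, let the
transfer-operator iterates be `δ`-close to their limit from length `p ≥ ℓ = m + 1` on (`δ` small as
in `exists_delta_small`) and let `c₀` be a local-gap constant for the open chains of lengths in
`[2p, 3p)`. Then for every ring `ℤ/L`, `L ≥ 3p`, the parent Hamiltonian `H = Σ_x h_x` has the
spectral gap `1/(6 c₀)` above its unique ground state `ringMPS L A`: with the coarse-grained
projections `E_k = (h_{n_k})_{C_k}` on the unions `C_k` of two consecutive segments of a tiling of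
the ring (`exists_ring_tiling`) and `K = Σ_k E_k`, one has `K² ≥ (1/3) K`
(`fnw_ring_sq_sub_smul_posSemidef`, cross terms by `posSemidef_pair_ring`), `K ≤ 2 c₀ H` (local
gaps, each `h_x` lying in at most two `C_k`), and `ker K ⊆ ker H` (each `h_x ≤ E_k` for the `C_k`
containing the block at `x`), whence `gap(H) ≥ (1/3)/(2 c₀)`
(`hasSpectralGap_of_dominated_sq_sub_smul`). [cite: FannesNachtergaeleWernerCMP1992, Thm. 6.4] -/
theorem hasSpectralGap_parentHamiltonian_of_tiling [NeZero D] {A : MPSTensor q D} {m : ℕ}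
    (hinj : IsInjectiveMPS A m) (hm : 0 < m) {ρ : Matrix (Fin D) (Fin D) ℂ}
    (h1 : transferOp A 1 = 1) (hρ : transferOp (fun i => (A i)ᴴ) ρ = ρ)
    (hρ1 : (1 - ρ).PosSemidef) {lam : ℝ} (hlam : 0 < lam)
    (hlamρ : (ρ - (lam : ℂ) • (1 : Matrix (Fin D) (Fin D) ℂ)).PosSemidef)
    {δ : ℝ} (hδ0 : 0 ≤ δ) (hδlam : δ * (D : ℝ) ^ 2 ≤ lam / 2)
    (hε : 2 / lam * (δ * (D : ℝ) ^ 2 * Real.sqrt lam⁻¹ +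
        (δ * (D : ℝ) ^ 2) ^ 2 * lam⁻¹ ^ 2 * Real.sqrt lam⁻¹) ≤ 1 / 4)
    {p : ℕ} (hpℓ : m + 1 ≤ p)
    (hδn : ∀ n, p ≤ n → ∀ a d i j : Fin D, ‖((transferOp A ^ n) (Matrix.single a d 1) -
      ρ d a • (1 : Matrix (Fin D) (Fin D) ℂ)) i j‖ ≤ δ)
    {c₀ : ℝ} (hc₀ : 0 < c₀)
    (hgap : ∀ n, 2 * p ≤ n → n < 3 * p →
      ((c₀ : ℂ) • parentHamiltonianOpen n (m + 1) A - parentLocalTerm n A).PosSemidef)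
    (L : ℕ) [NeZero L] (hL : 3 * p ≤ L) :
    (parentHamiltonian L (m + 1) A).HasSpectralGap ((1 / 3) / (2 * c₀)) := by
  obtain ⟨N, _, hN3, c, len, hc1, hlenp, hlen3, hlenL, hbij⟩ :=
    exists_ring_tiling (by omega : 0 < p) L hL
  -- notation: the `ℓ`-block terms, the coarse-grained projections, `K`
  set hx : ZMod L → Op (ZMod L) q := fun x =>
    localOp (ringBlock L (m + 1) x) (onRingBlock L (m + 1) x (parentLocalTerm (m + 1) A)) with hhx
  set E : ZMod N → Op (ZMod L) q := fun k =>
    localOp (ringBlock L (len k + len (k + 1)) (c k))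
      (onRingBlock L (len k + len (k + 1)) (c k) (parentLocalTerm (len k + len (k + 1)) A)) with hE
  set K : Op (ZMod L) q := ∑ k, E k with hK
  have hH : parentHamiltonian L (m + 1) A = ∑ x, hx x := rfl
  have hxpsd : ∀ x, (hx x).PosSemidef := fun x =>
    posSemidef_localOp _ (posSemidef_onRingBlock L (m + 1) x (parentLocalTerm_posSemidef (m + 1) A))
  have hnL : ∀ k, len k + len (k + 1) ≤ L := fun k => le_trans (Nat.le_add_right _ _) (hlenL k)
  have hEherm : ∀ k, (E k).IsHermitian := fun k => isHermitian_bigBlock L _ (c k) A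
  have hEidem : ∀ k, E k * E k = E k := fun k => bigBlock_mul_self L (hnL k) (c k) A
  have hEpsd : ∀ k, (E k).PosSemidef := fun k => posSemidef_bigBlock L _ (c k) A
  -- the segments are pairwise disjoint, a big block is the union of two consecutive segments
  have hseg : ∀ k k' : ZMod N, k ≠ k' →
      Disjoint (ringBlock L (len k) (c k)) (ringBlock L (len k') (c k')) := by
    intro k k' hkk'
    rw [Finset.disjoint_left]
    intro y hy hy'
    obtain ⟨i, rfl⟩ := (mem_ringBlock_iff _ _).1 hy
    obtain ⟨i', hi'⟩ := (mem_ringBlock_iff _ _).1 hy'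
    have h := @hbij.1 ⟨k, i⟩ ⟨k', i'⟩ hi'
    exact hkk' (congrArg Sigma.fst h)
  have hblock : ∀ k, ringBlock L (len k + len (k + 1)) (c k) =
      ringBlock L (len k) (c k) ∪ ringBlock L (len (k + 1)) (c (k + 1)) := by
    intro k
    rw [ringBlock_add, hc1]
  have hcomm : ∀ k d : ZMod N, d ≠ 0 → d ≠ 1 → d ≠ -1 → E k * E (k + d) = E (k + d) * E k := by
    intro k d hd0 hd1 hdm1
    apply bigBlock_commute
    rw [hblock, hblock, Finset.disjoint_union_left, Finset.disjoint_union_right,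
      Finset.disjoint_union_right]
    refine ⟨⟨hseg _ _ fun h => hd0 ?_, hseg _ _ fun h => hdm1 ?_⟩,
      hseg _ _ fun h => hd1 ?_, hseg _ _ fun h => hd0 ?_⟩
    · exact (add_eq_left.1 h.symm)
    · have h' : k + (d + 1) = k + 0 := by rw [← add_assoc, ← h, add_zero]
      exact eq_neg_of_add_eq_zero_left (add_left_cancel h')
    · exact (add_left_cancel h).symm
    · have h' : k + 1 + d = k + 1 + 0 := by rw [add_zero, add_right_comm]; exact h.symm
      exact add_left_cancel h'
  -- the cross terms (FNW Lemma 6.2 + 6.3)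
  have hpair : ∀ k : ZMod N, (E k * E (k + 1) + E (k + 1) * E k +
      (((1 / 3 : ℝ) : ℝ) : ℂ) • (E k + E (k + 1))).PosSemidef := by
    intro k
    have h := posSemidef_pair_ring A h1 hρ hρ1 hlam hlamρ (a := len k) (b := len (k + 1))
      (c := len (k + 1 + 1)) (by have := hlenp (k + 1); omega) L (hlenL k) (c k) hδ0 hδlam
      (hδn _ (hlenp _)) (hδn _ (le_trans (hlenp k) (Nat.le_add_right _ _)))
      (hδn _ (le_trans (hlenp (k + 1)) (Nat.le_add_right _ _))) hε
      (by norm_num : (0 : ℝ) ≤ 1 / 3) (by norm_num : (1 / 3 : ℝ) * (1 - 1 / 4) = 1 / 4)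
    rw [← hc1] at h
    exact h
  -- (i) `K² ≥ (1/3) K`
  have hsq : (K * K - ((1 / 3 : ℝ) : ℂ) • K).PosSemidef := by
    have h := fnw_ring_sq_sub_smul_posSemidef hN3 E hEherm hEidem hcomm hpair
    rw [show (1 - 2 * (1 / 3) : ℝ) = 1 / 3 by norm_num] at h
    exact h
  -- (ii) `K ≤ 2 c₀ H`
  set g : ZMod N → Op (ZMod L) q := fun k => ∑ i : Fin (len k), hx (c k + (((i : ℕ) : ℕ) : ZMod L))
    with hg
  have hsum_g : ∑ k, g k = parentHamiltonian L (m + 1) A := by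
    rw [hH, ← Fintype.sum_bijective _ hbij (fun ki => hx (c ki.1 + (((ki.2 : ℕ) : ℕ) : ZMod L)))
      hx (fun _ => rfl), Fintype.sum_sigma]
  have hsplit : ∀ k, ∑ j : Fin (len k + len (k + 1)), hx (c k + (((j : ℕ) : ℕ) : ZMod L)) =
      g k + g (k + 1) := by
    intro k
    rw [Fin.sum_univ_add]
    simp only [hg, Fin.val_castAdd, Fin.val_natAdd, hc1, Nat.cast_add, add_assoc]
  have hdom : (((2 * c₀ : ℝ) : ℂ) • parentHamiltonian L (m + 1) A - K).PosSemidef := by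
    have e1 : ((2 * c₀ : ℝ) : ℂ) • parentHamiltonian L (m + 1) A =
        ∑ k, (c₀ : ℂ) • ∑ j : Fin (len k + len (k + 1)), hx (c k + (((j : ℕ) : ℕ) : ZMod L)) := by
      simp only [hsplit, smul_add, Finset.sum_add_distrib, sum_shift (fun k => (c₀ : ℂ) • g k) 1,
        ← Finset.smul_sum, hsum_g]
      push_cast
      module
    rw [e1, hK, ← Finset.sum_sub_distrib]
    refine posSemidef_sum _ fun k _ => ?_
    have h2p : 2 * p ≤ len k + len (k + 1) := by have := hlenp k; have := hlenp (k + 1); omega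
    have hT := posSemidef_smul_sum_sub_bigBlock L (hnL k) (c k) A (hgap _ h2p (hlen3 k))
    have hdiff : ((c₀ : ℂ) • (∑ j : Fin (len k + len (k + 1)), hx (c k + (((j : ℕ) : ℕ) : ZMod L)) -
        ∑ j : Fin (len k + len (k + 1)), if (j : ℕ) + (m + 1) ≤ len k + len (k + 1) then
          hx (c k + (((j : ℕ) : ℕ) : ZMod L)) else 0)).PosSemidef := by
      refine PosSemidef.smul ?_ (Complex.zero_le_real.2 hc₀.le)
      rw [← Finset.sum_sub_distrib]
      refine posSemidef_sum _ fun j _ => ?_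
      split_ifs
      · simpa using PosSemidef.zero
      · simpa using hxpsd _
    have e2 : (c₀ : ℂ) • ∑ j : Fin (len k + len (k + 1)), hx (c k + (((j : ℕ) : ℕ) : ZMod L)) - E k =
        ((c₀ : ℂ) • (∑ j : Fin (len k + len (k + 1)), if (j : ℕ) + (m + 1) ≤ len k + len (k + 1) then
          hx (c k + (((j : ℕ) : ℕ) : ZMod L)) else 0) - E k) +
        (c₀ : ℂ) • (∑ j : Fin (len k + len (k + 1)), hx (c k + (((j : ℕ) : ℕ) : ZMod L)) -
          ∑ j : Fin (len k + len (k + 1)), if (j : ℕ) + (m + 1) ≤ len k + len (k + 1) then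
            hx (c k + (((j : ℕ) : ℕ) : ZMod L)) else 0) := by
      rw [smul_sub]
      abel
    rw [e2]
    exact hT.add hdiff
  -- (iii) `ker K ⊆ ker H`
  have hker : ∀ φ, K *ᵥ φ = 0 → parentHamiltonian L (m + 1) A *ᵥ φ = 0 := by
    intro φ hφ
    have hE0 : ∀ k, E k *ᵥ φ = 0 := fun k =>
      mulVec_eq_zero_of_sum_posSemidef (fun k _ => hEpsd k) hφ k (Finset.mem_univ k)
    have hx0 : ∀ x, hx x *ᵥ φ = 0 := by
      intro x
      obtain ⟨⟨k, i⟩, hki⟩ := hbij.2 x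
      have hj : (i : ℕ) + (m + 1) ≤ len k + len (k + 1) := by
        have := hlenp (k + 1); have := i.2; omega
      have hsub := posSemidef_bigBlock_sub_subBlock L (hnL k) (c k)
        (⟨i, by omega⟩ : Fin (len k + len (k + 1))) hj A
      rw [← hki]
      exact mulVec_eq_zero_of_posSemidef_sub (hxpsd _) hsub (hE0 k)
    rw [hH, Matrix.sum_mulVec]
    exact Finset.sum_eq_zero fun x _ => hx0 x
  -- the ground state
  have hψ0 : ringMPS L A ≠ 0 := ringMPS_ne_zero hinj hm L (by omega)
  have hHψ : parentHamiltonian L (m + 1) A *ᵥ ringMPS L A = 0 :=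
    parentHamiltonian_mulVec_mps_eq_zero_holds L (m + 1) (by omega) A
  have huniq : ∀ φ, parentHamiltonian L (m + 1) A *ᵥ φ = 0 → ∃ a : ℂ, φ = a • ringMPS L A :=
    fun φ h0 => exists_eq_smul_ringMPS hinj hm L (by omega) φ
      (exists_boundary_of_parentHamiltonian_mulVec_eq_zero' L (by omega) A φ h0)
  exact hasSpectralGap_of_dominated_sq_sub_smul (parentHamiltonian_posSemidef_holds L (m + 1) A)
    (posSemidef_sum _ fun k _ => hEpsd k) hψ0 hHψ huniq hker (by norm_num) (by positivity) hsq hdom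

/-! ### The uniform gap -/

/-- **Uniform gap in the normalised gauge.** For an injective tensor in the normalised gauge
(`𝔼(𝟙) = 𝟙`, `𝔼_*(ρ) = ρ`, `ρ > 0`, `tr ρ = 1`) there are `L₀` and `γ > 0` such that
`parentHamiltonian L (m+1) A` has the spectral gap `γ` for every `L ≥ L₀`.
[cite: FannesNachtergaeleWernerCMP1992, Thm. 6.4] -/
theorem exists_uniform_gap_parentHamiltonian_normalised [NeZero D] {A : MPSTensor q D} {m : ℕ}
    (hinj : IsInjectiveMPS A m) (hm : 0 < m) {ρ : Matrix (Fin D) (Fin D) ℂ}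
    (h1 : transferOp A 1 = 1) (hρ : transferOp (fun i => (A i)ᴴ) ρ = ρ) (hρpd : ρ.PosDef)
    (hρtr : ρ.trace = 1) :
    ∃ (L₀ : ℕ) (γ : ℝ), 0 < γ ∧ ∀ (L : ℕ) [NeZero L], L₀ ≤ L →
      (parentHamiltonian L (m + 1) A).HasSpectralGap γ := by
  obtain ⟨lam, hlam, hlamρ⟩ := exists_pos_sub_smul_posSemidef hρpd (isHermitian_one (n := Fin D) (α := ℂ))
  have hρ1 : (1 - ρ).PosSemidef := posSemidef_one_sub_of_trace_eq_one hρpd.posSemidef hρtr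
  obtain ⟨δ, hδ, hδlam, hε⟩ := exists_delta_small hlam (Dr := (D : ℝ))
    (by exact_mod_cast Nat.one_le_iff_ne_zero.2 (NeZero.ne D))
  obtain ⟨n₀, hn₀⟩ := transferOp_pow_single_sub_entry_le hinj h1 hρ hρpd.posSemidef hρtr hδ
  set p : ℕ := max n₀ (m + 1) with hp
  obtain ⟨c₀, hc₀, hgap⟩ := exists_forall_mem_finset_of_mono (s := Finset.Ico (2 * p) (3 * p))
    (P := fun n c => ((c : ℂ) • parentHamiltonianOpen n (m + 1) A - parentLocalTerm n A).PosSemidef)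
    (fun n c c' hcc' h => by
      have e : (c' : ℂ) • parentHamiltonianOpen n (m + 1) A - parentLocalTerm n A =
          ((c : ℂ) • parentHamiltonianOpen n (m + 1) A - parentLocalTerm n A) +
            ((c' - c : ℝ) : ℂ) • parentHamiltonianOpen n (m + 1) A := by
        push_cast
        module
      rw [e]
      exact h.add ((parentHamiltonianOpen_posSemidef n (m + 1) A).smul
        (Complex.zero_le_real.2 (by linarith))))
    (fun n hn => exists_pos_smul_parentHamiltonianOpen_sub_parentLocalTerm hinj hm
      (by simp only [Finset.mem_Ico] at hn; omega))
  refine ⟨3 * p, (1 / 3) / (2 * c₀), by positivity, fun L _ hL => ?_⟩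
  exact hasSpectralGap_parentHamiltonian_of_tiling hinj hm h1 hρ hρ1 hlam hlamρ hδ.le hδlam hε
    (le_max_right _ _) (fun n hn => hn₀ n (le_trans (le_max_left _ _) hn)) hc₀
    (fun n h2 h3 => hgap n (by simp only [Finset.mem_Ico]; omega)) L hL

/-- **Uniform gap for an injective tensor** (gauge reduction to the normalised case,
`exists_normalised_gauge`, `parentHamiltonian_gauge`). [cite: FannesNachtergaeleWernerCMP1992, Thm. 6.4] -/
theorem exists_uniform_gap_parentHamiltonian [NeZero D] {A : MPSTensor q D} {m : ℕ} (hinj : IsInjectiveMPS A m)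
    (hm : 0 < m) :
    ∃ (L₀ : ℕ) (γ : ℝ), 0 < γ ∧ ∀ (L : ℕ) [NeZero L], L₀ ≤ L →
      (parentHamiltonian L (m + 1) A).HasSpectralGap γ := by
  obtain ⟨c, Y, ρ, hc, hY, hρpd, hρtr, h1, hρ⟩ := exists_normalised_gauge hinj hm
  obtain ⟨L₀, γ, hγ, h⟩ := exists_uniform_gap_parentHamiltonian_normalised (hinj.gauge hc hY) hm h1 hρ hρpd hρtr
  refine ⟨L₀, γ, hγ, fun L _ hL => ?_⟩
  rw [← parentHamiltonian_gauge A hc hY L (m + 1)]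
  exact h L hL

/-- **Discharge of `fannes_nachtergaele_werner_gap` (hubbard.S16; FNW Thm. 6.4, ring form).**
For a normal tensor `A` (injective at some `m ≥ 1`) take `ℓ₀ = max (m+1) ℓ₁` with `ℓ₁` the
uniqueness threshold of `fannes_nachtergaele_werner_unique`. For `ℓ ≥ ℓ₀`, `A` is injective at
`ℓ - 1`, so `exists_uniform_gap_parentHamiltonian` gives a gap `γ₀` for all rings `L ≥ L₀`; the finitely many rings
`2ℓ ≤ L < L₀` have unique ground states, hence gaps `γ_L > 0`
(`exists_hasSpectralGap_of_hasUniqueGroundState`); `γ = min` works for all `L ≥ 2ℓ`.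
[cite: FannesNachtergaeleWernerCMP1992, Thm. 6.4 with Lemma 6.1; PVWC QIC 2007 §4.2] -/
theorem fannes_nachtergaele_werner_gap_holds :
    fannes_nachtergaele_werner_gap (q := q) (D := D) := by
  intro _ A hA
  obtain ⟨ℓ₁, hℓ₁⟩ := fannes_nachtergaele_werner_unique_holds A hA
  obtain ⟨m, hm, hinj⟩ := hA
  refine ⟨max (m + 1) ℓ₁, fun ℓ hℓ => ?_⟩
  obtain ⟨m', rfl⟩ : ∃ m', ℓ = m' + 1 := ⟨ℓ - 1, by omega⟩
  have hinj' : IsInjectiveMPS A m' := hinj.of_le hm (by omega)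
  have hm' : 0 < m' := by omega
  obtain ⟨L₀, γ₀, hγ₀, hbig⟩ := exists_uniform_gap_parentHamiltonian hinj' hm'
  have hsmall : ∀ L ∈ Finset.Ico (2 * (m' + 1)) L₀, ∃ γ, 0 < γ ∧
      ∀ hL : NeZero L, (parentHamiltonian L (m' + 1) A).HasSpectralGap γ := by
    intro L hL
    simp only [Finset.mem_Ico] at hL
    haveI : NeZero L := ⟨by omega⟩
    obtain ⟨huq, -⟩ := hℓ₁ (m' + 1) (by omega) L hL.1
    obtain ⟨γ, hγ, hgapL⟩ := exists_hasSpectralGap_of_hasUniqueGroundState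
      (parentHamiltonian_posSemidef_holds L (m' + 1) A).1 huq
    exact ⟨γ, hγ, fun _ => hgapL⟩
  obtain ⟨γ₁, hγ₁, hsmall'⟩ := exists_forall_mem_finset_of_anti
    (P := fun L γ => ∀ hL : NeZero L, (parentHamiltonian L (m' + 1) A).HasSpectralGap γ)
    (fun L c c' hc' hcc' h hL => (h hL).anti hc' hcc') hsmall
  refine ⟨min γ₀ γ₁, lt_min hγ₀ hγ₁, fun L _ hL => ?_⟩
  by_cases hL₀ : L₀ ≤ L
  · exact (hbig L hL₀).anti (lt_min hγ₀ hγ₁) (min_le_left _ _)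
  · exact (hsmall' L (by simp only [Finset.mem_Ico]; omega) inferInstance).anti (lt_min hγ₀ hγ₁)
      (min_le_right _ _)

end QLattice

end Literature.MathematicalPhysics.QuantumLattice
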